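import Mathlib

/-!
# `NewtonUnitEquationsNewtonTauWeakTwoCoreChartRel` — relative two-core bound in chart language

Line `binomial-normal-form` of crux `NewtonTauWeak` (stmt-ValiantsHypothesis-5904), lead c7, stub P12: the base
case `k = 1` of the core-splitting induction `N(2^k cores) ≤ 2^{k-1} (k+1)^{|V|}`, read THROUGH a sub-universe
`V ⊆ Fin x`.  A two-core DESIGN is `h : Fin 2 → Finset (Fin x) → ℕ²`; a configuration `f : Fin x → Fin 2` has the
`V`-relative point `P_V f = h 0 (V ∩ f⁻¹ 0) + h 1 (V ∩ f⁻¹ 1)` (elements outside `V` are ignored), and the stub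
bounds the number of LOWER-HULL VERTICES of the cloud `C = {P_V f}` — the `σ = −1` chart points, i.e. the strict
maximisers over `C` of a height `t·q₀ − q₁`, `t ∈ ℝ` — by `2^{|V|}`.

Proof.  The chart set is a subset of the cloud `C`, and `C` has at most `2^{|V|}` points: `P_V f` depends only on
`S = V ∩ f⁻¹ 1 ∈ 𝒫(V)`, since `V ∩ f⁻¹ 0 = V \ S` (`Fin 2` has exactly the two elements `0, 1`), so
`C ⊆ 𝒫(V).image (S ↦ h 0 (V \ S) + h 1 S)` and `|C| ≤ |𝒫(V)| = 2^{|V|}`.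

`stub_twoCoreChartRel` is the registered stub text, verbatim.  Folklore-level; Mathlib only; no citations, no `def`s.
-/

-- Sub = Summit single-conjunct layout: the duplicated namespace component is mandated by the tree.
set_option linter.dupNamespace false

open scoped BigOperators

namespace Summit.ValiantsHypothesis.ValiantsHypothesis.Theorems.NewtonUnitEquationsNewtonTauWeak

namespace TwoCoreChartRelAux

/-- COMPLEMENTARY FIBRES: for a two-colouring `f`, the `V`-relative `0`-fibre is the complement in `V` of the
`V`-relative `1`-fibre. [folklore] -/
theorem fibre_zero_eq_sdiff {x : ℕ} (f : Fin x → Fin 2) (V : Finset (Fin x)) :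
    (V ∩ Finset.univ.filter fun u => f u = 0) = V \ (V ∩ Finset.univ.filter fun u => f u = 1) := by
  have key : ∀ a : Fin 2, a = 0 ↔ ¬a = 1 := by decide
  ext u
  simp only [Finset.mem_inter, Finset.mem_filter, Finset.mem_univ, true_and, Finset.mem_sdiff, key (f u)]
  tauto

/-- THE CLOUD IS CODED BY SUBSETS OF `V`: every `V`-relative point `P_V f` is `h 0 (V \ S) + h 1 S` for the subset
`S = V ∩ f⁻¹ 1 ⊆ V`. [folklore] -/
theorem image_subset_powerset_image {x : ℕ} (V : Finset (Fin x)) (h : Fin 2 → Finset (Fin x) → (Fin 2 →₀ ℕ)) :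
    (Finset.univ.image fun f : Fin x → Fin 2 => ∑ d, h d (V ∩ Finset.univ.filter fun u => f u = d)) ⊆
      V.powerset.image fun S => h 0 (V \ S) + h 1 S := by
  intro p hp
  simp only [Finset.mem_image, Finset.mem_univ, true_and, Finset.mem_powerset] at hp ⊢
  obtain ⟨f, rfl⟩ := hp
  refine ⟨V ∩ Finset.univ.filter fun u => f u = 1, Finset.inter_subset_left, ?_⟩
  rw [Fin.sum_univ_two, fibre_zero_eq_sdiff f V]

/-- THE CLOUD HAS AT MOST `2^{|V|}` POINTS. [folklore] -/
theorem card_image_le {x : ℕ} (V : Finset (Fin x)) (h : Fin 2 → Finset (Fin x) → (Fin 2 →₀ ℕ)) :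
    (Finset.univ.image fun f : Fin x → Fin 2 => ∑ d, h d (V ∩ Finset.univ.filter fun u => f u = d)).card ≤
      2 ^ V.card :=
  calc (Finset.univ.image fun f : Fin x → Fin 2 => ∑ d, h d (V ∩ Finset.univ.filter fun u => f u = d)).card
      ≤ (V.powerset.image fun S => h 0 (V \ S) + h 1 S).card :=
        Finset.card_le_card (image_subset_powerset_image V h)
    _ ≤ V.powerset.card := Finset.card_image_le
    _ = 2 ^ V.card := Finset.card_powerset V

end TwoCoreChartRelAux

open TwoCoreChartRelAux in
/-- STUB P12 — **relative two-core bound in chart language**: a two-core design `h` read through `V ⊆ Fin x` has at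
most `2^{|V|}` lower-hull vertices (`σ = −1` chart points), because the chart set is a subset of the cloud and the
cloud is coded by the `2^{|V|}` subsets `S = V ∩ f⁻¹ 1` of `V`.  Base case `k = 1` of the core-splitting induction.
[folklore] -/
theorem stub_twoCoreChartRel (x : ℕ) (V : Finset (Fin x)) (h : Fin 2 → Finset (Fin x) → (Fin 2 →₀ ℕ)) :
    {p : Fin 2 →₀ ℕ | p ∈ (Finset.univ.image fun f : Fin x → Fin 2 =>
          ∑ d, h d (V ∩ Finset.univ.filter fun u => f u = d)) ∧
        ∃ t : ℝ, ∀ q ∈ (Finset.univ.image fun f : Fin x → Fin 2 =>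
          ∑ d, h d (V ∩ Finset.univ.filter fun u => f u = d)), q ≠ p →
          t * ((q 0 : ℕ) : ℝ) + (-1) * ((q 1 : ℕ) : ℝ) < t * ((p 0 : ℕ) : ℝ) + (-1) * ((p 1 : ℕ) : ℝ)}.ncard ≤ 2 ^ V.card := by
  -- the chart set sits inside the cloud `C`, and `|C| ≤ 2^{|V|}`
  refine le_trans (b := (↑(Finset.univ.image fun f : Fin x → Fin 2 =>
      ∑ d, h d (V ∩ Finset.univ.filter fun u => f u = d)) : Set (Fin 2 →₀ ℕ)).ncard) ?_ ?_
  · exact Set.ncard_le_ncard (fun p hp => Finset.mem_coe.2 hp.1) (Finset.finite_toSet _)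
  · rw [Set.ncard_coe_finset]
    exact card_image_le V h

end Summit.ValiantsHypothesis.ValiantsHypothesis.Theorems.NewtonUnitEquationsNewtonTauWeak
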